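import Literature.AnabelianGeometry.AbsoluteAnabelian.AbsTopILem45iModelProofs
import Literature.AnabelianGeometry.AbsoluteAnabelian.AbsTopISemiAbsoluteClosures
import Literature.AnabelianGeometry.AbsoluteAnabelian.FreeProSigmaNonVacuity
import HarnessLib

/-!
# [AbsTopI] Lemma 4.5 (i) `CuspidalData.NonProperIffFree` — CLOSED INSTANCE FORMS at the split
# surface-group models `Γ̂_{g,0} × G_k ↠ G_k` (proper, no cusp) and `F̂_{n+1} × G_k ↠ G_k` (affine, one
# cusp) (FACT-LIST row F-0208)

S. Mochizuki, *Topics in Absolute Anabelian Geometry I: Generalities* (2012) [MochizukiAbsTopI2012],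
Lemma 4.5 (i) p. 54: "`X` is non-proper if and only if every torsion-free pro-`Σ` open subgroup of `Δ`
is free pro-`Σ`."  abc-iut-L4-t4 typed it as the predicate
`FundamentalExtension.CuspidalData.NonProperIffFree C S` (`AbsTopIChains.lean`): `Nonempty C.Cusp ↔`
every open, torsion-free, pro-`Σ` `H ≤ Δ` is free pro-`Σ`.

PROOF-ONLY companion (theorems only: no `def`, no `instance`, no `structure`, no notation); abc-iut
cell, block F, seat abc-iut-f-057, KEY row INST59H1.  State of the row in the LF kernel census #6:
«∀-closure REFUTED (schema)» (`CuspidalData.not_forall_nonProperIffFree`,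
`exists_not_nonProperIffFree`, abc-iut-f-060) with CONDITIONAL closers only
(`nonProperIffFree_of_isProSigmaCompletion_{closed,punctured}SurfaceGroup`,
`nonProperIffFree_of_isFreeProOn`, `AbsTopILem45iModelProofs.lean`) — no theorem whose conclusion head is
LITERALLY the declaration at DATA.  This file discharges the closers' hypotheses at GENUINE profinite data
the tree constructs (Mathlib's profinite completion `profiniteCompletion`, the tree's
`IsProSigmaCompletion.isProSigmaCompletion_toCompletion`, abc-iut-f-089's split surface model
`exists_isProSigmaCompletion_geom_splitSurfaceModel`, `isFreeProOn_profiniteCompletion_freeGroup`) and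
states the results with the extension AND the cuspidal datum WRITTEN OUT AS TERMS:

* PROPER models — `nonProperIffFree_splitClosedSurfaceModel g k`: the split extension
  `Π = Ŝ_{g+2} × G_k ↠ G_k` (`Ŝ_{g+2}` = profinite completion of the closed surface group `Γ_{g+2,0}`,
  genus `≥ 2`; `k` any field of characteristic zero) with the CUSPLESS cuspidal datum satisfies
  `NonProperIffFree · Primes`: both sides are false — no cusp, and `H = Δ ≅ Ŝ_{g+2}` is open, torsion-free,
  pro-finite but NOT free (abc-iut-L4's rank argument `not_isFreePro_of_isProSigmaCompletion_surfaceGroup`);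
  closed specialisation `nonProperIffFree_splitClosedSurfaceModel_genusTwo_rat` (`g = 2`, `k = ℚ`);
* AFFINE models — `nonProperIffFree_splitFreeModel n k`: `Π = F̂_{n+1} × G_k ↠ G_k` (`F̂_{n+1}` = the
  free profinite group on `x_0, …, x_n` = profinite completion of `π₁^{top}` of a sphere with `n + 2`
  punctures) with ONE cusp whose decomposition group is `D = cl⟨η x_0⟩ × G_k` (the pro-cyclic closure of
  the loop `x_0` times `G_k`; `I = D ∩ Δ = cl⟨η x_0⟩ × 1`) satisfies `NonProperIffFree · Primes`: both
  sides are true — a cusp, and EVERY open subgroup of the free profinite `Δ` is free pro-finite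
  (Schreier; abc-iut-L4-t15's `IsFreeProOn.isFreePro_of_isOpen` inside `nonProperIffFree_of_isFreeProOn`);
  closed specialisation `nonProperIffFree_splitFreeTwoModel_rat` (`F̂_2`, `k = ℚ`).

HONEST LABEL: SPLIT models (trivial outer Galois action) with a hand-placed cusp — `Δ` has the genuine
shape of a geometric fundamental group (`Ŝ_g`, `F̂_{n+1}`), but `Π` is NOT the étale `π₁` of a curve
over `k` (no such `π₁` is constructed in the tree, abc-iut FOUNDATIONS row 12); classical profinite group
theory; an instance form about OUR typed predicate; instantiated ≠ endorsed; typed ≠ proved; nothing here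
bears on [IUTchIII] Cor. 3.12 or takes a side.
-/

noncomputable section

namespace Literature.AnabelianGeometry.AbsoluteAnabelian.FundamentalExtension

open Literature.GroupTheory.CombinatorialGroupTheory (PuncturedSurfaceGroup)
open Literature.IUT.HodgeTheaters (profiniteCompletion toCompletion)

/-! ### The geometric part of a split extension `A × G_k ↠ G_k` is a copy of `A` -/

/-- For a profinite group `A` and a field `k` of characteristic zero, `Δ = Ker(pr₂) = A × 1` of the split
extension `A × G_k ↠ G_k` is isomorphic to `A` as a topological group (`a ↦ (a, 1)`).
-- adapted from abc-iut-f-089's private `nonempty_equiv_geom_split` (`AbsTopISemiAbsoluteClosures.lean`).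
[folklore] -/
private theorem nonempty_continuousMulEquiv_geom_split (A : ProfiniteGrp.{0}) (k : Type) [Field k]
    [CharZero k] :
    Nonempty (A ≃ₜ*
      ↥(({ arith := ProfiniteGrp.of (A × Field.absoluteGaloisGroup k)
           gal := absoluteGaloisGrp k
           aug := ContinuousMonoidHom.snd _ _
           aug_surjective := fun y => ⟨(1, y), rfl⟩ } : FundamentalExtension.{0}).geom)) := by
  refine ⟨{ toFun := fun a => ⟨(a, 1), rfl⟩
            invFun := fun x => x.1.1
            left_inv := fun _ => rfl
            right_inv := ?_
            map_mul' := fun _ _ => rfl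
            continuous_toFun := ?_
            continuous_invFun := continuous_fst.comp continuous_subtype_val }⟩
  · rintro ⟨⟨a, y⟩, hy⟩
    have hy' : y = 1 := hy
    subst hy'
    rfl
  · exact (continuous_id.prodMk continuous_const).subtype_mk _

/-! ### PROPER models: `Ŝ_{g+2} × G_k ↠ G_k`, no cusp -/

/-- **F-0208, CLOSED INSTANCE FORM at the PROPER split surface models** ([AbsTopI] Lem 4.5 (i) as typed):
for every `g` and every field `k` of characteristic zero, the split extension `Ŝ_{g+2} × G_k ↠ G_k`
(`Δ ≅ Ŝ_{g+2}`, the profinite completion of the genus-`(g+2)` closed surface group, receiving the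
pro-`Primes` completion `Γ_{g+2,0} → Δ`) with the CUSPLESS cuspidal datum satisfies `NonProperIffFree`
for `Σ = Primes`: there is no cusp, and the group side fails at `H = Δ` (open in itself, torsion-free,
pro-finite, not free pro-finite) — abc-iut-L4's `nonProperIffFree_of_isProSigmaCompletion_closedSurfaceGroup`
at genuine data.  SPLIT model, not the `π₁` of a curve. [cite: MochizukiAbsTopI2012, Lemma 4.5 (i) p.54] -/
theorem CuspidalData.nonProperIffFree_splitClosedSurfaceModel (g : ℕ) (k : Type) [Field k] [CharZero k] :
    Literature.AnabelianGeometry.AbsoluteAnabelian.FundamentalExtension.CuspidalData.NonProperIffFree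
      (E := { arith := ProfiniteGrp.of
                (profiniteCompletion (PuncturedSurfaceGroup (g + 2) 0) × Field.absoluteGaloisGroup k)
              gal := absoluteGaloisGrp k
              aug := ContinuousMonoidHom.snd _ _
              aug_surjective := fun y => ⟨(1, y), rfl⟩ })
      { Cusp := PEmpty
        Dcusp := fun x => x.elim
        Icusp := fun x => x.elim
        Icusp_eq := fun x => x.elim
        isClosed_Dcusp := fun x => x.elim
        eq_of_conj := fun x => x.elim }
      {p : ℕ | p.Prime} := by
  obtain ⟨ι, hι⟩ := exists_isProSigmaCompletion_geom_splitSurfaceModel (g + 2) k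
  exact CuspidalData.nonProperIffFree_of_isProSigmaCompletion_closedSurfaceGroup
    (hC := inferInstanceAs (IsEmpty PEmpty)) _ ⟨2, Nat.prime_two, Nat.prime_two⟩ (by omega) ι hι

/-- **F-0208 at a 0-binder term (proper case)**: the split genus-`2` closed-surface model over `ℚ`,
`Ŝ_2 × G_ℚ ↠ G_ℚ`, cuspless datum, `Σ = Primes`. [cite: MochizukiAbsTopI2012, Lemma 4.5 (i) p.54] -/
theorem CuspidalData.nonProperIffFree_splitClosedSurfaceModel_genusTwo_rat :
    Literature.AnabelianGeometry.AbsoluteAnabelian.FundamentalExtension.CuspidalData.NonProperIffFree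
      (E := { arith := ProfiniteGrp.of
                (profiniteCompletion (PuncturedSurfaceGroup 2 0) × Field.absoluteGaloisGroup ℚ)
              gal := absoluteGaloisGrp ℚ
              aug := ContinuousMonoidHom.snd _ _
              aug_surjective := fun y => ⟨(1, y), rfl⟩ })
      { Cusp := PEmpty
        Dcusp := fun x => x.elim
        Icusp := fun x => x.elim
        Icusp_eq := fun x => x.elim
        isClosed_Dcusp := fun x => x.elim
        eq_of_conj := fun x => x.elim }
      {p : ℕ | p.Prime} :=
  CuspidalData.nonProperIffFree_splitClosedSurfaceModel 0 ℚ

/-! ### AFFINE models: `F̂_{n+1} × G_k ↠ G_k`, one cusp `D = cl⟨η x_0⟩ × G_k` -/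

/-- **F-0208, CLOSED INSTANCE FORM at the AFFINE split free models** ([AbsTopI] Lem 4.5 (i) as typed): for
every `n` and every field `k` of characteristic zero, the split extension `F̂_{n+1} × G_k ↠ G_k` (`Δ ≅ F̂_{n+1}`,
the free profinite group on `x_0, …, x_n`) with the ONE-CUSP cuspidal datum `D = cl⟨η x_0⟩ × G_k`
(`I = D ∩ Δ`) satisfies `NonProperIffFree` for `Σ = Primes`: there is a cusp, and every open subgroup of
the free profinite `Δ` is free pro-finite (Schreier) — abc-iut-L4's `nonProperIffFree_of_isFreeProOn` at
the genuine datum `isFreeProOn_profiniteCompletion_freeGroup`, transported along `F̂_{n+1} ≃ₜ* Δ`.  SPLIT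
model with a hand-placed cusp, not the `π₁` of a curve. [cite: MochizukiAbsTopI2012, Lemma 4.5 (i) p.54] -/
theorem CuspidalData.nonProperIffFree_splitFreeModel (n : ℕ) (k : Type) [Field k] [CharZero k] :
    Literature.AnabelianGeometry.AbsoluteAnabelian.FundamentalExtension.CuspidalData.NonProperIffFree
      (E := { arith := ProfiniteGrp.of
                (profiniteCompletion (FreeGroup (Fin (n + 1))) × Field.absoluteGaloisGroup k)
              gal := absoluteGaloisGrp k
              aug := ContinuousMonoidHom.snd _ _
              aug_surjective := fun y => ⟨(1, y), rfl⟩ })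
      { Cusp := Unit
        Dcusp := fun _ =>
          Subgroup.comap (MonoidHom.fst _ (Field.absoluteGaloisGroup k))
            (Subgroup.zpowers
              (toCompletion (FreeGroup (Fin (n + 1))) (FreeGroup.of 0))).topologicalClosure
        Icusp := fun _ =>
          Subgroup.comap (MonoidHom.fst _ (Field.absoluteGaloisGroup k))
              (Subgroup.zpowers
                (toCompletion (FreeGroup (Fin (n + 1))) (FreeGroup.of 0))).topologicalClosure ⊓
            (ContinuousMonoidHom.snd (profiniteCompletion (FreeGroup (Fin (n + 1))))
              (Field.absoluteGaloisGroup k)).toMonoidHom.ker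
        Icusp_eq := fun _ => rfl
        isClosed_Dcusp := fun _ => (Subgroup.isClosed_topologicalClosure _).preimage continuous_fst
        eq_of_conj := fun _ _ _ _ => rfl }
      {p : ℕ | p.Prime} := by
  obtain ⟨e⟩ :=
    nonempty_continuousMulEquiv_geom_split (profiniteCompletion (FreeGroup (Fin (n + 1)))) k
  exact CuspidalData.nonProperIffFree_of_isFreeProOn _
    ((isFreeProOn_profiniteCompletion_freeGroup (n + 1)).of_continuousMulEquiv e) (Nat.succ_pos n)

/-- **F-0208 at a 0-binder term (affine case)**: `F̂_2 × G_ℚ ↠ G_ℚ` (the geometric fundamental group of a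
once-punctured torus / thrice-punctured line has the shape `F̂_2`), one cusp `D = cl⟨η x_0⟩ × G_ℚ`,
`Σ = Primes`. [cite: MochizukiAbsTopI2012, Lemma 4.5 (i) p.54] -/
theorem CuspidalData.nonProperIffFree_splitFreeTwoModel_rat :
    Literature.AnabelianGeometry.AbsoluteAnabelian.FundamentalExtension.CuspidalData.NonProperIffFree
      (E := { arith := ProfiniteGrp.of
                (profiniteCompletion (FreeGroup (Fin 2)) × Field.absoluteGaloisGroup ℚ)
              gal := absoluteGaloisGrp ℚ
              aug := ContinuousMonoidHom.snd _ _
              aug_surjective := fun y => ⟨(1, y), rfl⟩ })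
      { Cusp := Unit
        Dcusp := fun _ =>
          Subgroup.comap (MonoidHom.fst _ (Field.absoluteGaloisGroup ℚ))
            (Subgroup.zpowers (toCompletion (FreeGroup (Fin 2)) (FreeGroup.of 0))).topologicalClosure
        Icusp := fun _ =>
          Subgroup.comap (MonoidHom.fst _ (Field.absoluteGaloisGroup ℚ))
              (Subgroup.zpowers (toCompletion (FreeGroup (Fin 2)) (FreeGroup.of 0))).topologicalClosure ⊓
            (ContinuousMonoidHom.snd (profiniteCompletion (FreeGroup (Fin 2)))
              (Field.absoluteGaloisGroup ℚ)).toMonoidHom.ker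
        Icusp_eq := fun _ => rfl
        isClosed_Dcusp := fun _ => (Subgroup.isClosed_topologicalClosure _).preimage continuous_fst
        eq_of_conj := fun _ _ _ _ => rfl }
      {p : ℕ | p.Prime} :=
  CuspidalData.nonProperIffFree_splitFreeModel 1 ℚ

end Literature.AnabelianGeometry.AbsoluteAnabelian.FundamentalExtension

end
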